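import Summits.Ventures.Crystal3D.Theorems.StickyWulffConstantCoaxialWallLawReachCoreOfRows
import Summits.Ventures.Crystal3D.Theorems.StickyWulffConstantCoaxialWallLawDebtTwinRowGen
import Summits.Ventures.Crystal3D.Theorems.StickyWulffConstantCoaxialWallLawDebtFaultRowGen
import HarnessLib

/-!
# The crux `CoaxialWallLaw` from E1 and the two census rows AT EVERY VERSION (v1/v2) — the v2 transition, closed

HONEST FRAMING. Venture `Summits/Ventures/Crystal3D` (cell `crystal3d-full`), helper `--supports` the crux
`CoaxialWallLaw` of `route-Ventures-StickyWulffConstant` (REGISTERED line `WallLedgerF`).  Rung credit; F-C1 not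
moved; CONDITIONAL on named facts.  cf-p1 g28 DECISION (xxxviii″)/§86(116): the census key is `WordVersion.v2` (the
NARROW straight move added to the automaton); this file is `…ReachCoreOfRows` VERBATIM with the two census rows at
version `ver` — `EndRowTwinHalfTurn ver s_F`, `EndRowTrans ver s_F` (`…EndRowDefs`) — fed by the version-parametric
chain (`…WordMovesGen` … `…DebtTwinRowGen` / `…DebtFaultRowGen`).  At `ver = v2` the rows count only pairs whose target is
not even NARROW-moving (lit g15 / 19481-p1 g12: v1 needs `s_F ≥ 339/70 > 2√6`-compatible margins fail; v2 reads `≤ 16/5`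
on the kernel rows of record).

* `coaxialTwoSlabAdhesionOn_reachTranslation_of_row_gen`, `coaxialTwoSlabAdhesionOn_twin_of_halfTurnRow_gen`,
  `coaxialTwoSlabAdhesionReach_of_twoRows_gen`, `reachDebts_of_twoRows_gen`, `coaxialTwoSlabAdhesion_of_twoRows_gen`;
* **`coaxialWallLaw_of_twoRows_gen`** :
  `KissingGap δ → KissingClassification δ → 0 < s_F ≤ 2√6 → EndRowTwinHalfTurn ver s_F → EndRowTrans ver s_F → E1 →
   StarPairFar → CoaxialWallLaw`;
* `coaxialWallLaw_of_twoRows_p5_gen` — E1 as `P5Exhaustion`.  (The computational-grade leaf with the kissing facts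
  and `StarPairFar` plugged is `…TwoRowsCertifiedGen`.)
WHAT THIS IS NOT: the rows themselves (census facts, cf-p2 / lit); F-C1 not moved.
-/

noncomputable section

namespace Summit.Ventures.Crystal3D.Theorems

open Summit.Ventures.Crystal3D Finset NearIdentity
open Summit.Ventures.Crystal3D.Cruxes.CoaxialWallLaw.WallLedgerF (CoaxialTwoSlabAdhesion)
open Literature.MathematicalPhysics.StatisticalMechanics (fccStacking barlowStacking IsHaggSeq constHagg
  isHaggSeq_const contactDeficiency)
open scoped InnerProductSpace

/-! ### The reach core from the two rows -/

section Rows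

variable (ver : WordVersion) {δ : ℝ} (hg : KissingGap δ) (hc : KissingClassification δ)
variable {sF : ℝ} (hsF : 0 < sF) (hsF' : sF ≤ 2 * Real.sqrt 6)

section Trans

include hg hc hsF hsF'

open scoped Classical in
/-- **Reach-registered TRANSLATION pairs from the in-plane translation row** (they are class (C)). -/
theorem coaxialTwoSlabAdhesionOn_reachTranslation_of_row_gen (hrowT : EndRowTrans ver sF) :
    CoaxialTwoSlabAdhesionOn fun A₁ t₁ A₂ t₂ =>
      ReachPair A₁ t₁ A₂ t₂ ∧ A₂ '' fccStacking 1 (Real.sqrt (2 / 3)) = A₁ '' fccStacking 1 (Real.sqrt (2 / 3)) := by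
  intro A₁ t₁ A₂ t₂ _ hne hS
  obtain ⟨hR, hΛ₂⟩ := hS
  have htrans : A₁ '' fccStacking 1 (Real.sqrt (2 / 3)) = A₂ '' fccStacking 1 (Real.sqrt (2 / 3)) := hΛ₂.symm
  set e₃ : EuclideanSpace ℝ (Fin 3) := EuclideanSpace.single (2 : Fin 3) (1 : ℝ) with he₃
  set τ : EuclideanSpace ℝ (Fin 3) := A₁.symm (t₂ - t₁) with hτ
  have hτΛ : τ ∉ fccStacking 1 (Real.sqrt (2 / 3)) := offset_notMem_of_ne A₁ A₂ t₁ t₂ htrans hne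
  obtain ⟨c, hcube⟩ := cube_of_reach_translation A₁ t₁ A₂ t₂ hR hΛ₂ hτΛ
  obtain ⟨L', hL', hskew⟩ := exists_skewFrame_of_cube A₁ τ c hcube
  obtain ⟨C, R₀, hR₀, hmain⟩ := coaxialTwoSlabAdhesion_trans_skew_row_gen ver hg hc A₁ t₁ A₂ t₂ L' hL' htrans hskew hsF
    (hrowT L')
  refine ⟨L', t₁, t₂, constHagg, constHagg, isHaggSeq_const, isHaggSeq_const,
    movedFcc_subset_frame_of_image_eq A₁ L' t₁ hL'.symm,
    movedFcc_subset_frame_of_image_eq A₂ L' t₂ (hΛ₂.trans hL'.symm), C, R₀, hR₀, ?_⟩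
  intro h hh ρ hρ X P₁ P₂ hX hP₁X hP₂X₁ hcyl hP₁ hP₂
  have key := hmain h hh ρ hρ X P₁ P₂ hX hP₁X hP₂X₁ hcyl hP₁ hP₂
  have hhalf : (1 / 2 : ℝ) * Real.sqrt (1 - ⟪L' e₃, e₃⟫_ℝ ^ 2) ≤ Real.sqrt 6 / sF * Real.sqrt (1 - ⟪L' e₃, e₃⟫_ℝ ^ 2) := by
    refine mul_le_mul_of_nonneg_right ?_ (Real.sqrt_nonneg _)
    rw [le_div_iff₀ hsF]
    linarith only [hsF']
  have hπρ : 0 ≤ Real.pi * ρ ^ 2 := by positivity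
  have := mul_le_mul_of_nonneg_right hhalf hπρ
  linarith only [key, this]

end Trans

section Twin

include hg hc hsF hsF'

open scoped Classical in
/-- **ALL twin pairs (`A₁·Λ₀ ≠ A₂·Λ₀`) from the twin half-turn row.** -/
theorem coaxialTwoSlabAdhesionOn_twin_of_halfTurnRow_gen (hrowW : EndRowTwinHalfTurn ver sF) :
    CoaxialTwoSlabAdhesionOn fun A₁ _ A₂ _ =>
      A₁ '' fccStacking 1 (Real.sqrt (2 / 3)) ≠ A₂ '' fccStacking 1 (Real.sqrt (2 / 3)) := by
  intro A₁ t₁ A₂ t₂ hcoax _ htwin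
  obtain ⟨L, s₁, s₂, σ, σ', hσ, hσ', hsub₁, hsub₂⟩ := hcoax
  set e₃ : EuclideanSpace ℝ (Fin 3) := EuclideanSpace.single (2 : Fin 3) (1 : ℝ) with he₃
  have hRR : ∀ L' : EuclideanSpace ℝ (Fin 3) ≃ₗᵢ[ℝ] EuclideanSpace ℝ (Fin 3),
      ((ℝ ∙ e₃).reflection).trans (((ℝ ∙ e₃).reflection).trans L') = L' := fun L' =>
    LinearIsometryEquiv.ext fun x => by
      simp only [LinearIsometryEquiv.trans_apply, Submodule.reflection_reflection]
  have hrow : ∀ F : Bool → (EuclideanSpace ℝ (Fin 3) ≃ₗᵢ[ℝ] EuclideanSpace ℝ (Fin 3)),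
      (F false = L ∧ F true = ((ℝ ∙ e₃).reflection).trans L ∨
        F false = ((ℝ ∙ e₃).reflection).trans L ∧ F true = L) →
      LocalEndRow ver sF ⟨F false, inPlaneRoots (F false) 1⟩ ⟨F true, inPlaneRoots (F true) (-1)⟩ := by
    rintro F (⟨h0, h1⟩ | ⟨h0, h1⟩)
    · rw [h0, h1]; exact hrowW L
    · have := hrowW (((ℝ ∙ e₃).reflection).trans L)
      rw [hRR] at this
      rw [h0, h1]; exact this
  obtain ⟨C, R₀, hR₀, hmain⟩ := coaxialTwoSlabAdhesion_general_twin_of_row_gen ver hg hc A₁ t₁ A₂ t₂ L s₁ s₂ σ σ'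
    hσ hσ' hsub₁ hsub₂ htwin hsF hsF' hrow
  exact ⟨L, s₁, s₂, σ, σ', hσ, hσ', hsub₁, hsub₂, C, R₀, hR₀, hmain⟩

end Twin

include hg hc hsF hsF'

/-- **THE REACH CORE FROM THE TWO CENSUS ROWS.**  See the module docstring. -/
theorem coaxialTwoSlabAdhesionReach_of_twoRows_gen (hrowW : EndRowTwinHalfTurn ver sF) (hrowT : EndRowTrans ver sF) :
    CoaxialTwoSlabAdhesionReach := by
  intro A₁ t₁ A₂ t₂ hco hne hR
  by_cases hΛ : A₂ '' fccStacking 1 (Real.sqrt (2 / 3)) = A₁ '' fccStacking 1 (Real.sqrt (2 / 3))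
  · exact coaxialTwoSlabAdhesionOn_reachTranslation_of_row_gen ver hg hc hsF hsF' hrowT A₁ t₁ A₂ t₂ hco hne ⟨hR, hΛ⟩
  · exact coaxialTwoSlabAdhesionOn_twin_of_halfTurnRow_gen ver hg hc hsF hsF' hrowW A₁ t₁ A₂ t₂ hco hne (Ne.symm hΛ)

/-- **R3 BY NAME**: the reach-registered deep debt `CoaxialTwoSlabAdhesionReachIncoherentDeep` from the two rows. -/
theorem coaxialTwoSlabAdhesionReachIncoherentDeep_of_twoRows_gen (hrowW : EndRowTwinHalfTurn ver sF)
    (hrowT : EndRowTrans ver sF) : CoaxialTwoSlabAdhesionReachIncoherentDeep :=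
  (split_of_coaxialTwoSlabAdhesionReach (coaxialTwoSlabAdhesionReach_of_twoRows_gen ver hg hc hsF hsF' hrowW hrowT)).2.2

/-- R1 and R2 BY NAME as well (for the record; R1/R2 were already the rows' by `…DebtTwinRow` / `…DebtFaultRow`). -/
theorem reachDebts_of_twoRows_gen (hrowW : EndRowTwinHalfTurn ver sF) (hrowT : EndRowTrans ver sF) :
    CoaxialTwoSlabAdhesionReachCoherentTwin ∧ CoaxialTwoSlabAdhesionReachCoherentFault ∧
      CoaxialTwoSlabAdhesionReachIncoherentDeep :=
  split_of_coaxialTwoSlabAdhesionReach (coaxialTwoSlabAdhesionReach_of_twoRows_gen ver hg hc hsF hsF' hrowW hrowT)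

open scoped Classical in
/-- **The registered stub `stub_coaxialTwoSlabAdhesion` IN FULL from E1, `StarPairFar` and the two census rows.** -/
theorem coaxialTwoSlabAdhesion_of_twoRows_gen (hrowW : EndRowTwinHalfTurn ver sF) (hrowT : EndRowTrans ver sF)
    {s₀ : EuclideanSpace ℝ (Fin 3)} (hs₀ : s₀ ∈ fccSlots)
    (hcert : ExactOnly 0 (fccSlots.filter fun w => 0 < ⟪w, s₀⟫_ℝ)) (hSP : StarPairFar) :
    CoaxialTwoSlabAdhesion :=
  coaxialTwoSlabAdhesion_of_reach hs₀ hcert hSP (coaxialTwoSlabAdhesionReach_of_twoRows_gen ver hg hc hsF hsF' hrowW hrowT)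

open scoped Classical in
/-- **THE CRUX `CoaxialWallLaw` BY NAME FROM E1, `StarPairFar` AND THE TWO CENSUS ROWS** — no incoherent, deep or
(F-loc) hypothesis remains. -/
theorem coaxialWallLaw_of_twoRows_gen (hrowW : EndRowTwinHalfTurn ver sF) (hrowT : EndRowTrans ver sF)
    {s₀ : EuclideanSpace ℝ (Fin 3)} (hs₀ : s₀ ∈ fccSlots)
    (hcert : ExactOnly 0 (fccSlots.filter fun w => 0 < ⟪w, s₀⟫_ℝ)) (hSP : StarPairFar) :
    Summit.Ventures.Crystal3D.Theses.StickyWulffConstant.CoaxialWallLaw :=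
  coaxialWallLaw_of_reach hs₀ hcert hSP (coaxialTwoSlabAdhesionReach_of_twoRows_gen ver hg hc hsF hsF' hrowW hrowT)

/-- The same from `P5Exhaustion` (E1 as the certified computation). -/
theorem coaxialWallLaw_of_twoRows_p5_gen (hrowW : EndRowTwinHalfTurn ver sF) (hrowT : EndRowTrans ver sF)
    (hE1 : P5Exhaustion) (hSP : StarPairFar) :
    Summit.Ventures.Crystal3D.Theses.StickyWulffConstant.CoaxialWallLaw := by
  obtain ⟨s₀, hs₀, hcert⟩ := exactOnly_star_of_p5Exhaustion hE1
  exact coaxialWallLaw_of_twoRows_gen ver hg hc hsF hsF' hrowW hrowT hs₀ hcert hSP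

end Rows

end Summit.Ventures.Crystal3D.Theorems

end
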